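import Mathlib
import Summits.ResolutionOfSingularities.ResolutionOfSingularities.Theorems.FrobeniusLadderFRationalResolutionCompletedBaseChangeFibreFlat
import Summits.ResolutionOfSingularities.ResolutionOfSingularities.Theorems.FrobeniusLadderFRationalResolutionPointBlowupOfCompletion

/-!
# Crux `FrobeniusLadder.FRationalResolution` (stmt-ResolutionOfSingularities-15317), line `redirect`,
# stub `stub_diagonalizableQuotientResolution` — THE TRANSPORT STEP (T) ON THE BLOW-UP CHARTS, COMPLETIONS:
# `(T[I/a]_𝔫)^ ≅ (Ê[IÊ/a]_{𝔑'})^`, hence **`Bl_𝔪` regularity at the points of `Bl_{IÊ}(Spec Ê)` over `V(𝔪̂)` is read off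
# on the model `Bl_I(Spec T)`**

Fourth file of the (T) series (`…CompletedBaseChangeFibre`, `…Flat`, `…Chart`). The two-step recipes at a twisted isolated
point (`…MaximalIdealTower.hloc_of_maximalIdealPow_then_singularPoints`, `…IntrinsicRecipeFinite`) need, at every singular
point `z` of `X₁ = Bl_{JÊ}(Spec Ê)` over `V(𝔪̂)`, the regularity of `Bl_{𝔪_z}(Spec 𝒪_{X₁,z})`; and
`…PointBlowupOfCompletion.isRegular_affineBlowup_maximalIdeal_of_ringEquiv_adicCompletion` reduces this to a ring
isomorphism `𝒪̂_{X₁,z} ≅ (B_𝔮)^` with `B` of finite type over a field, `𝔮` maximal, `Bl_𝔮(Spec B)` regular. Here that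
isomorphism is PRODUCED chartwise, with `B = T[I/a]` the chart ring of the model:
* `exists_ringEquiv_adicCompletion_of_ringEquiv` — a ring isomorphism of local rings induces one of the adic completions
  (`R ≅ S` is flat, unramified, residue-trivial: the engine `…CompletionOfFlatUnramified`);
* `exists_ringEquiv_adicCompletion_atPrime_of_ringEquiv` — `Θ : D ≃+* D'`, `𝔑'` a prime of `D'`:
  `(D_{Θ⁻¹𝔑'})^ ≅ (D'_{𝔑'})^` compatibly (`IsLocalization.ringEquivOfRingEquiv`);
* ★★ `exists_ringEquiv_adicCompletion_of_presentation` — `B` flat over `A` with `B = A + 𝔪B`, `ψ : C → C'` PRESENTED as a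
  base change by `Θ : C ⊗_A B ≅ C'`, `Θ(c ⊗ 1) = ψ c` (for the chart rings `A[I/a] → B[IB/a]`:
  `…CompletedBaseChangeFibreChart.exists_ringEquiv_tensor_blowupAlgebra`), `𝔑'` a prime of `C'` over `V(𝔪C)`:
  **`(C_{ψ⁻¹𝔑'})^ ≃+* (C'_{𝔑'})^`** compatibly with `ψ`;
* ★★★ **`isRegular_affineBlowup_maximalIdeal_model`** — MODEL FORM: `T` of finite type over a field `K`, `𝔳` maximal,
  `Ê = (T_𝔳)^`, `C` of finite type over `T` (the chart ring `T[I₀/a₀]`), `ψ : C → C'` presented by `Θ : C ⊗_T Ê ≅ C'`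
  (the chart ring `Ê[I₀Ê/a₀]`), `𝔑'` a prime of `C'` contracting to a MAXIMAL `𝔫 ⊇ 𝔳C` with `Bl_𝔫(Spec C)` regular ⇒
  **`Bl_𝔪(Spec C'_{𝔑'})` is regular** — the `hloc` input of the two-step recipes, read off on the model chart (what remains
  is the scheme bookkeeping `𝒪_{X₁,z} ≅ Ê[I₀Ê/a₀]_{𝔑'}`, tree `…BlowupChartPoints.exists_chart_prime` pattern). The
  presented form is used because `AdicCompletion (maximalIdeal (Localization.AtPrime 𝔑')) _` does not elaborate at statement
  level for `𝔑'` an ideal of the subalgebra-of-localization type `blowupAlgebra …` (deterministic `whnf` time-out; the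
  instantiation with `Θ` from `…CompletedBaseChangeFibreChart.exists_ringEquiv_tensor_blowupAlgebra` is one `exact` inside
  the consumer's proof).

Honest label: ring-level plumbing toward ONE leaf stub (no stub, crux or summit closed). No definitions, no named facts,
no sorry. [cite: Matsumura1987, Thm. 8.4; Thm. 8.14; Thm. 23.7; §32, Cor. of Thm. 32.6] [cite: StacksProject, Tag 0805;
Tag 0C4G] [cite: GortzWedhorn2020, Prop. 13.91 (2)]
-/

noncomputable section

-- single-problem summit: the doubled namespace component is forced
set_option linter.dupNamespace false

open IsLocalRing AlgebraicGeometry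
open scoped TensorProduct
open Literature.AlgebraicGeometry.Resolution

namespace Summit.ResolutionOfSingularities.ResolutionOfSingularities.Theorems.FRationalResolution.CompletedBaseChangeFibreCompletion

/-! ## §1 Completions along ring isomorphisms -/

/-- **A ring isomorphism of local rings induces an isomorphism of the adic completions** (it is flat, unramified and
residue-trivial). [cite: Matsumura1987, Thm. 8.4] [folklore] -/
theorem exists_ringEquiv_adicCompletion_of_ringEquiv {R S : Type} [CommRing R] [CommRing S] [IsLocalRing R]
    [IsLocalRing S] (e : R ≃+* S) :
    ∃ ê : AdicCompletion (maximalIdeal R) R ≃+* AdicCompletion (maximalIdeal S) S,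
      ∀ r : R, ê (algebraMap R _ r) = algebraMap S _ (e r) := by
  letI : Algebra R S := e.toRingHom.toAlgebra
  have halg : ∀ r : R, algebraMap R S r = e r := fun _ => rfl
  haveI : IsLocalHom (algebraMap R S) :=
    ⟨fun a ha => by
      rw [halg] at ha
      simpa using ha.map (e.symm : S →+* R)⟩
  -- `S ≅ R` as an `R`-module, so `S` is flat
  let L : S ≃ₗ[R] R :=
    { e.symm.toAddEquiv with
      map_smul' := fun r s => by
        change e.symm (r • s) = r * e.symm s
        rw [Algebra.smul_def, halg, map_mul, RingEquiv.symm_apply_apply] }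
  haveI : Module.Flat R S := Module.Flat.of_linearEquiv L
  have hm : (maximalIdeal R).map (algebraMap R S) = maximalIdeal S := by
    have := PointBlowupOfCompletion.map_maximalIdeal_ringEquiv e
    rwa [← RingEquiv.toRingHom_eq_coe] at this
  have hres : ∀ b : S, ∃ a : R, b - algebraMap R S a ∈ maximalIdeal S := fun b =>
    ⟨e.symm b, by rw [halg, RingEquiv.apply_symm_apply, sub_self]; exact Ideal.zero_mem _⟩
  obtain ⟨ê, -, hê⟩ := CompletionOfFlatUnramified.exists_ringEquiv_adicCompletion_of_flat hm hres
  exact ⟨ê, fun r => by rw [hê, halg]⟩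

/-- **`(D_{Θ⁻¹𝔑'})^ ≅ (D'_{𝔑'})^` along a ring isomorphism `Θ : D ≃+* D'`**, compatibly with `D → D'`.
[cite: Matsumura1987, Thm. 8.4] [folklore] -/
theorem exists_ringEquiv_adicCompletion_atPrime_of_ringEquiv {D D' : Type} [CommRing D] [CommRing D']
    (Θ : D ≃+* D') (𝔑' : Ideal D') [𝔑'.IsPrime] :
    ∃ ê : AdicCompletion (maximalIdeal (Localization.AtPrime (𝔑'.comap Θ.toRingHom)))
          (Localization.AtPrime (𝔑'.comap Θ.toRingHom)) ≃+*
        AdicCompletion (maximalIdeal (Localization.AtPrime 𝔑')) (Localization.AtPrime 𝔑'),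
      ∀ d : D, ê (algebraMap _ _ (algebraMap D (Localization.AtPrime (𝔑'.comap Θ.toRingHom)) d)) =
        algebraMap _ _ (algebraMap D' (Localization.AtPrime 𝔑') (Θ d)) := by
  have hmem : ∀ s, s ∈ 𝔑'.comap Θ.toRingHom ↔ Θ s ∈ 𝔑' := fun _ => Iff.rfl
  have H : Submonoid.map Θ.toMonoidHom (𝔑'.comap Θ.toRingHom).primeCompl = 𝔑'.primeCompl := by
    ext t
    constructor
    · rintro ⟨s, hs, rfl⟩
      exact fun ht => hs ((hmem s).mpr ht)
    · intro ht
      refine ⟨Θ.symm t, fun hs => ht ?_, by simp⟩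
      have := (hmem _).mp hs
      rwa [RingEquiv.apply_symm_apply] at this
  let f : Localization.AtPrime (𝔑'.comap Θ.toRingHom) ≃+* Localization.AtPrime 𝔑' :=
    IsLocalization.ringEquivOfRingEquiv (Localization.AtPrime (𝔑'.comap Θ.toRingHom)) (Localization.AtPrime 𝔑') Θ H
  have hf : ∀ d : D, f (algebraMap D _ d) = algebraMap D' _ (Θ d) := fun d =>
    IsLocalization.ringEquivOfRingEquiv_eq H d
  obtain ⟨ê, hê⟩ := exists_ringEquiv_adicCompletion_of_ringEquiv f
  exact ⟨ê, fun d => by rw [hê, hf]⟩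

/-! ## §2 A presented base change `Θ : C ⊗_A B ≅ C'` (e.g. the chart rings `A[I/a] → B[IB/a]`) -/

variable {A B C C' : Type} [CommRing A] [CommRing B] [CommRing C] [CommRing C'] [Algebra A B] [Algebra A C]

/-- ★★ **`(C_{ψ⁻¹𝔑'})^ ≅ (C'_{𝔑'})^`** for `B` flat over `A` with `B = A + 𝔪B`, a ring homomorphism `ψ : C → C'` PRESENTED as
the base change by a ring isomorphism `Θ : C ⊗_A B ≅ C'` with `Θ(c ⊗ 1) = ψ c` (for the chart rings `A[I/a] → B[IB/a]` of two
blowing ups this is `…CompletedBaseChangeFibreChart.exists_ringEquiv_tensor_blowupAlgebra`), and a prime `𝔑'` of `C'` over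
`V(𝔪C)`. [cite: Matsumura1987, Thm. 8.4; Thm. 8.14] [cite: StacksProject, Tag 0805; Tag 0C4G] -/
theorem exists_ringEquiv_adicCompletion_of_presentation [Module.Flat A B] (𝔪 : Ideal A)
    (hres : ∀ b : B, ∃ x : A, b - algebraMap A B x ∈ 𝔪.map (algebraMap A B))
    (ψ : C →+* C') (Θ : C ⊗[A] B ≃+* C') (hΘ : ∀ c : C, Θ (algebraMap C (C ⊗[A] B) c) = ψ c)
    (𝔑' : Ideal C') [𝔑'.IsPrime] (h𝔑' : 𝔪.map (algebraMap A C) ≤ 𝔑'.comap ψ) :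
    ∃ ê : AdicCompletion (maximalIdeal (Localization.AtPrime (𝔑'.comap ψ))) (Localization.AtPrime (𝔑'.comap ψ)) ≃+*
        AdicCompletion (maximalIdeal (Localization.AtPrime 𝔑')) (Localization.AtPrime 𝔑'),
      ∀ c : C, ê (algebraMap _ _ (algebraMap C (Localization.AtPrime (𝔑'.comap ψ)) c)) =
        algebraMap _ _ (algebraMap C' (Localization.AtPrime 𝔑') (ψ c)) := by
  haveI h𝔑p : (𝔑'.comap Θ.toRingHom).IsPrime := Ideal.comap_isPrime _ _
  have hmem : ∀ s, s ∈ 𝔑'.comap Θ.toRingHom ↔ Θ s ∈ 𝔑' := fun s => Iff.rfl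
  have h𝔑 : (𝔑'.comap Θ.toRingHom).comap (algebraMap C (C ⊗[A] B)) = 𝔑'.comap ψ := by
    ext r
    rw [Ideal.mem_comap, hmem, hΘ, Ideal.mem_comap]
  -- `(C_𝔫)^ ≅ ((C ⊗ B)_𝔑)^`
  obtain ⟨e₁, he₁⟩ := CompletedBaseChangeFibreFlat.exists_ringEquiv_adicCompletion (B := B) 𝔪 hres
    (𝔑'.comap ψ) h𝔑' (𝔑'.comap Θ.toRingHom) h𝔑
  -- `((C ⊗ B)_𝔑)^ ≅ (C'_𝔑')^` along `Θ`
  obtain ⟨e₂, he₂⟩ := exists_ringEquiv_adicCompletion_atPrime_of_ringEquiv Θ 𝔑'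
  refine ⟨e₁.trans e₂, fun c => ?_⟩
  rw [RingEquiv.trans_apply, he₁, Localization.localRingHom_to_map, he₂, hΘ]

/-! ## §3 The model form: `Bl_𝔪` regularity upstairs from the model -/

/-- ★★★ **MODEL FORM.** Let `T` be of finite type over a field `K`, `𝔳 ⊆ T` maximal, `Ê = (T_𝔳)^`, `C` a `T`-algebra of finite
type (a chart ring `T[I₀/a₀]` of `Bl_{I₀}(Spec T)`), `ψ : C → C'` with `C'` Noetherian presented as the base change to `Ê` by
`Θ : C ⊗_T Ê ≅ C'`, `Θ(c ⊗ 1) = ψ c` (for the chart rings: `…CompletedBaseChangeFibreChart.exists_ringEquiv_tensor_blowupAlgebra`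
with `B = Ê`, flat by `…Flat.flat_adicCompletion_atPrime`), and `𝔑'` a prime of `C'` whose contraction `𝔫 = ψ⁻¹𝔑'` is a
MAXIMAL ideal containing `𝔳C` (a closed point over `𝔳`). If `Bl_𝔫(Spec C)` is regular, then **`Bl_𝔪(Spec C'_{𝔑'})` is
regular** — the `hloc` input of the two-step recipes at the points of `Bl_{I₀Ê}(Spec Ê)` over `V(𝔪̂)`, read off on the model.
[cite: Matsumura1987, Thm. 8.14; Thm. 23.7; §32, Cor. of Thm. 32.6] [cite: StacksProject, Tag 0805] [cite: GortzWedhorn2020, Prop. 13.91 (2)] -/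
theorem isRegular_affineBlowup_maximalIdeal_model (K : Type) [Field K] (T : Type) [CommRing T] [Algebra K T]
    [Algebra.FiniteType K T] (𝔳 : Ideal T) [𝔳.IsMaximal]
    (C : Type) [CommRing C] [Algebra T C] [Algebra.FiniteType T C] (C' : Type) [CommRing C'] [IsNoetherianRing C']
    (ψ : C →+* C')
    (Θ : C ⊗[T] AdicCompletion (maximalIdeal (Localization.AtPrime 𝔳)) (Localization.AtPrime 𝔳) ≃+* C')
    (hΘ : ∀ c : C, Θ (algebraMap C _ c) = ψ c)
    (𝔑' : Ideal C') [𝔑'.IsPrime] [(𝔑'.comap ψ).IsMaximal] (h𝔑' : 𝔳.map (algebraMap T C) ≤ 𝔑'.comap ψ)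
    (hreg : Scheme.IsRegular (affineBlowup (𝔑'.comap ψ))) :
    Scheme.IsRegular (affineBlowup (maximalIdeal (Localization.AtPrime 𝔑'))) := by
  haveI : IsNoetherianRing T := Algebra.FiniteType.isNoetherianRing K T
  haveI : IsNoetherianRing (Localization.AtPrime 𝔑') :=
    IsLocalization.isNoetherianRing 𝔑'.primeCompl (Localization.AtPrime 𝔑') inferInstance
  letI : Algebra K C := ((algebraMap T C).comp (algebraMap K T)).toAlgebra
  haveI : IsScalarTower K T C := IsScalarTower.of_algebraMap_eq (fun _ => rfl)
  haveI : Algebra.FiniteType K C := Algebra.FiniteType.trans (S := T) inferInstance inferInstance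
  haveI := CompletedBaseChangeFibreFlat.flat_adicCompletion_atPrime T 𝔳
  obtain ⟨ê, -⟩ := exists_ringEquiv_adicCompletion_of_presentation 𝔳
    (CompletedBaseChangeFibreFlat.forall_exists_sub_mem_adicCompletion_atPrime T 𝔳) ψ Θ hΘ 𝔑' h𝔑'
  exact PointBlowupOfCompletion.isRegular_affineBlowup_maximalIdeal_of_ringEquiv_adicCompletion K _ hreg ê

end Summit.ResolutionOfSingularities.ResolutionOfSingularities.Theorems.FRationalResolution.CompletedBaseChangeFibreCompletion

end
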